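import Mathlib
import Summits.Ventures.HodgeRepro.Tier4.Target

/-!
# Tier4/Line2/IsogenyPushforward — pushing an Albanese lift forward along a diagonal isogeny, and how the target's
integrand scales (t4-plan-2 g2's cut (iv), S13163; lead g385 S13166)

Blind re-derivation cell `pub-hodge-repro`, Tier 4 (README §9–§10), LINE L2, seat t4-L2-p2 (gen 2).  Target tree path
`lean/Summits/Ventures/HodgeRepro/Tier4/Line2/IsogenyPushforward.lean`.  Imports `Tier4.Target` only.

THE RUNG.  A diagonal isogeny `ℂ^T/Λ′ → ℂ^T/Λ`, `v ↦ (σ ↦ c σ · v σ)` with every `c σ ≠ 0` and `c · Λ′ ⊆ Λ`, carries an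
Albanese lift `a′` onto `ℂ^T/Λ′` to the Albanese lift `z ↦ (σ ↦ c σ · a′ z σ)` onto `ℂ^T/Λ`
(`isAlbaneseLift_diag_comp`: holomorphy coordinatewise, `Γ`-equivariance modulo `c · Λ′ ⊆ Λ`, the span of the
differences is the image of `⊤` under the invertible diagonal map).  The target's objects scale accordingly:
`comp` picks the `s`-coordinate (`c ⟨s, hs⟩` times the original — definitional), the Hecke translate of the scaled
lift is the scaled Hecke translate (`heckeTranslate` is additive in the lift: `heckeTranslate_map`), `pd` and
`jacDet` are homogeneous (`pd_const_mul` by `fderiv_const_mul`, with the non-differentiable case split;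
`jacDet_const_mul` bilinear), so the integrand of `P_T4` for the pushed-forward quadruple is
`c₁ c₂ · conj(c₃ c₄)` times the original one (`integrand_diag`) and its integral over any `D` is non-zero iff the
original is (`integral_diag_ne_zero_iff`).  This is what makes «N2-compatible data» a CHOICE of lifts into the GIVEN
tori rather than a scope clause (plan-2 S13163 (iv)).  No printed input.

Nothing here asserts anything about the Hodge conjecture for CM abelian varieties, which is NOT proved (HC_CM is NOT
proved by anyone in this repository).
-/

set_option autoImplicit false

noncomputable section

namespace Summit.Ventures.HodgeRepro.Tier4

open Matrix MeasureTheory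
open scoped ComplexConjugate

section Diag

variable {K : Type*} [Field K] (T : Finset (K →+* ℂ))

/-- **The diagonal scaling** `v ↦ (σ ↦ c σ · v σ)` of `ℂ^T`, as a `ℂ`-linear map. -/
def diagScale (c : ↥T → ℂ) : (↥T → ℂ) →ₗ[ℂ] (↥T → ℂ) where
  toFun v := fun σ => c σ * v σ
  map_add' v w := by
    funext σ
    simp [mul_add]
  map_smul' r v := by
    funext σ
    simp [mul_left_comm]

/-- `diagScale c v σ = c σ * v σ`. -/
@[simp]
theorem diagScale_apply (c : ↥T → ℂ) (v : ↥T → ℂ) (σ : ↥T) : diagScale T c v σ = c σ * v σ := rfl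

/-- The diagonal scaling by non-zero scalars is surjective (`v = diagScale c (fun σ => (c σ)⁻¹ * v σ)`). -/
theorem diagScale_surjective (c : ↥T → ℂ) (hc : ∀ σ, c σ ≠ 0) : Function.Surjective (diagScale T c) := by
  intro v
  refine ⟨fun σ => (c σ)⁻¹ * v σ, ?_⟩
  funext σ
  simp only [diagScale_apply]
  rw [← mul_assoc, mul_inv_cancel₀ (hc σ), one_mul]

/-- The range of the diagonal scaling by non-zero scalars is everything. -/
theorem diagScale_range (c : ↥T → ℂ) (hc : ∀ σ, c σ ≠ 0) : LinearMap.range (diagScale T c) = ⊤ :=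
  LinearMap.range_eq_top.2 (diagScale_surjective T c hc)

/-- The pushed-forward lift `z ↦ (σ ↦ c σ · a′ z σ)` is `diagScale c ∘ a′`. -/
theorem diag_comp_eq (c : ↥T → ℂ) (a' : (Fin 2 → ℂ) → (↥T → ℂ)) :
    (fun z σ => c σ * a' z σ) = fun z => diagScale T c (a' z) := rfl

/-- **ISOGENY PUSHFORWARD**: an Albanese lift onto `ℂ^T/Λ′` pushed forward along the diagonal isogeny `c` with
`c · Λ′ ⊆ Λ` is an Albanese lift onto `ℂ^T/Λ`. -/
theorem isAlbaneseLift_diag_comp (Λ Λ' : Submodule ℤ (↥T → ℂ)) {E : Type*} [Field E] (τ₀ : E →+* ℂ)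
    (C : Matrix (Fin 3) (Fin 3) ℂ) (Γ' : Set (Matrix (Fin 3) (Fin 3) E)) (a' : (Fin 2 → ℂ) → (↥T → ℂ))
    (c : ↥T → ℂ) (hc : ∀ σ, c σ ≠ 0) (hΛ : ∀ v ∈ Λ', (fun σ => c σ * v σ) ∈ Λ) :
    IsAlbaneseLift T Λ' τ₀ C Γ' a' → IsAlbaneseLift T Λ τ₀ C Γ' (fun z σ => c σ * a' z σ) := by
  rintro ⟨hdiff, hequiv, hspan⟩
  refine ⟨?_, ?_, ?_⟩
  · -- holomorphy, coordinatewise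
    rw [differentiableOn_pi]
    intro σ
    have := (differentiableOn_pi.1 hdiff) σ
    exact this.const_mul (c σ)
  · -- equivariance modulo `Λ ⊇ c · Λ′`
    intro γ hγ z hz
    have h := hΛ _ (hequiv γ hγ z hz)
    convert h using 1
    funext σ
    simp [mul_sub]
  · -- the span of the differences: the image of `⊤` under the surjective `diagScale c`
    have hset : {w : ↥T → ℂ | ∃ z ∈ ball, ∃ z' ∈ ball, w = (fun σ => c σ * a' z σ) - (fun σ => c σ * a' z' σ)} =
        diagScale T c '' {w : ↥T → ℂ | ∃ z ∈ ball, ∃ z' ∈ ball, w = a' z - a' z'} := by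
      ext w
      constructor
      · rintro ⟨z, hz, z', hz', rfl⟩
        refine ⟨a' z - a' z', ⟨z, hz, z', hz', rfl⟩, ?_⟩
        funext σ
        simp [mul_sub]
      · rintro ⟨v, ⟨z, hz, z', hz', rfl⟩, rfl⟩
        refine ⟨z, hz, z', hz', ?_⟩
        funext σ
        simp [mul_sub]
    rw [hset, Submodule.span_image, hspan, Submodule.map_top, diagScale_range T c hc]

end Diag

section Scaling

variable {K : Type*} [Field K] (T : Finset (K →+* ℂ))

/-- The `s`-coordinate of the pushed-forward lift is `c ⟨s, hs⟩` times the `s`-coordinate of the original. -/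
theorem comp_diag (s : K →+* ℂ) (hs : s ∈ T) (c : ↥T → ℂ) (A : (Fin 2 → ℂ) → (↥T → ℂ)) :
    comp T s hs (fun z σ => c σ * A z σ) = fun z => c ⟨s, hs⟩ * comp T s hs A z := rfl

/-- **The Hecke translate is additive in the lift**: it commutes with every additive map of the target group. -/
theorem heckeTranslate_map {E : Type*} [Field E] {W W' : Type*} [AddCommGroup W] [AddCommGroup W']
    (τ₀ : E →+* ℂ) (C : Matrix (Fin 3) (Fin 3) ℂ) (h : HeckeElement E) (D : W →+ W') (a : (Fin 2 → ℂ) → W) :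
    heckeTranslate τ₀ C h (fun z => D (a z)) = fun z => D (heckeTranslate τ₀ C h a z) := by
  funext z
  unfold heckeTranslate
  rw [map_list_sum, List.map_map]
  congr 1
  apply List.map_congr_left
  intro t _
  simp only [Function.comp, map_zsmul, map_sum]

/-- The Hecke translate of the pushed-forward lift is the pushed-forward Hecke translate. -/
theorem heckeTranslate_diag {E : Type*} [Field E] (τ₀ : E →+* ℂ) (C : Matrix (Fin 3) (Fin 3) ℂ)
    (h : HeckeElement E) (c : ↥T → ℂ) (A : (Fin 2 → ℂ) → (↥T → ℂ)) :
    heckeTranslate τ₀ C h (fun z σ => c σ * A z σ) = fun z σ => c σ * heckeTranslate τ₀ C h A z σ := by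
  have := heckeTranslate_map τ₀ C h (diagScale T c).toAddMonoidHom A
  simpa [diag_comp_eq] using this

/-- `∂_k (b · u) = b · ∂_k u` (for non-differentiable `u` and `b ≠ 0` both sides are `0`; for `b = 0` both are `0`). -/
theorem pd_const_mul (k : Fin 2) (b : ℂ) (u : (Fin 2 → ℂ) → ℂ) (z : Fin 2 → ℂ) :
    pd k (fun w => b * u w) z = b * pd k u z := by
  unfold pd
  by_cases hu : DifferentiableAt ℂ u z
  · rw [fderiv_const_mul hu b]
    rfl
  · by_cases hb : b = 0
    · subst hb
      simp
    · have hnd : ¬ DifferentiableAt ℂ (fun w => b * u w) z := by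
        intro hd
        apply hu
        have h2 := hd.const_mul b⁻¹
        have h3 : (fun y => b⁻¹ * (b * u y)) = u := by
          funext w
          rw [← mul_assoc, inv_mul_cancel₀ hb, one_mul]
        rw [h3] at h2
        exact h2
      rw [fderiv_zero_of_not_differentiableAt hu, fderiv_zero_of_not_differentiableAt hnd]
      simp

/-- The Jacobian determinant is bilinear in the two coordinate functions. -/
theorem jacDet_const_mul (b₁ b₂ : ℂ) (u v : (Fin 2 → ℂ) → ℂ) (z : Fin 2 → ℂ) :
    jacDet (fun w => b₁ * u w) (fun w => b₂ * v w) z = b₁ * b₂ * jacDet u v z := by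
  unfold jacDet wedge
  simp only [pd_const_mul]
  ring

/-- **The target's integrand for the pushed-forward quadruple** is `c₁ c₂ · conj(c₃ c₄)` times the original integrand
(`c_i` = the relevant coordinate of the `i`-th scaling). -/
theorem integrand_diag {E : Type*} [Field E] (τ₀ : E →+* ℂ) (C : Matrix (Fin 3) (Fin 3) ℂ)
    (T₁ T₂ T₃ T₄ : Finset (K →+* ℂ)) (s s' : K →+* ℂ) (hs₁ : s ∈ T₁) (hs₂ : s ∈ T₂) (hs₃ : s' ∈ T₃) (hs₄ : s' ∈ T₄)
    (h₁ h₂ h₃ h₄ : HeckeElement E) (c₁ : ↥T₁ → ℂ) (c₂ : ↥T₂ → ℂ) (c₃ : ↥T₃ → ℂ) (c₄ : ↥T₄ → ℂ)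
    (a₁ : (Fin 2 → ℂ) → (↥T₁ → ℂ)) (a₂ : (Fin 2 → ℂ) → (↥T₂ → ℂ)) (a₃ : (Fin 2 → ℂ) → (↥T₃ → ℂ))
    (a₄ : (Fin 2 → ℂ) → (↥T₄ → ℂ)) (z : Fin 2 → ℂ) :
    jacDet (comp T₁ s hs₁ (heckeTranslate τ₀ C h₁ (fun z σ => c₁ σ * a₁ z σ)))
        (comp T₂ s hs₂ (heckeTranslate τ₀ C h₂ (fun z σ => c₂ σ * a₂ z σ))) z *
      conj (jacDet (comp T₃ s' hs₃ (heckeTranslate τ₀ C h₃ (fun z σ => c₃ σ * a₃ z σ)))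
        (comp T₄ s' hs₄ (heckeTranslate τ₀ C h₄ (fun z σ => c₄ σ * a₄ z σ))) z) =
    (c₁ ⟨s, hs₁⟩ * c₂ ⟨s, hs₂⟩ * conj (c₃ ⟨s', hs₃⟩ * c₄ ⟨s', hs₄⟩)) *
      (jacDet (comp T₁ s hs₁ (heckeTranslate τ₀ C h₁ a₁)) (comp T₂ s hs₂ (heckeTranslate τ₀ C h₂ a₂)) z *
        conj (jacDet (comp T₃ s' hs₃ (heckeTranslate τ₀ C h₃ a₃))
          (comp T₄ s' hs₄ (heckeTranslate τ₀ C h₄ a₄)) z)) := by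
  rw [heckeTranslate_diag T₁, heckeTranslate_diag T₂, heckeTranslate_diag T₃, heckeTranslate_diag T₄,
    comp_diag, comp_diag, comp_diag, comp_diag, jacDet_const_mul, jacDet_const_mul, map_mul, map_mul]
  ring

/-- **The integral transfers**: over any `D`, the integral of a non-zero constant multiple of an integrand is non-zero
iff the original integral is. -/
theorem integral_const_mul_ne_zero_iff {κ : ℂ} (hκ : κ ≠ 0) (D : Set (Fin 2 → ℂ)) (f : (Fin 2 → ℂ) → ℂ) :
    (∫ z in D, κ * f z) ≠ 0 ↔ (∫ z in D, f z) ≠ 0 := by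
  rw [integral_const_mul]
  exact mul_ne_zero_iff_left hκ

end Scaling

end Summit.Ventures.HodgeRepro.Tier4

end
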